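import Literature.Analysis.Complex.WindingCertificateAnchored
import HarnessLib

/-!
# E-CANARY Tier 2 — the abstract ASSEMBLY theorem (Architecture A of `E-CANARY-TIER2-DESIGN.md`)

rh-jensen-theory g10 (route `JensenLogBand`, support item `XiDerivEdgeReal`, J look-2 lifter (a)); landed verbatim by
rh-jensen-eng g8 for D3 of the E-CANARY line (director-rh g8 2026-08-27 05:14:47Z).
Pure analysis, ζ-free: if `f` is analytic on the closed rectangle `K = [a,b] × [c,d]` with `c < 0 < d`,
REAL on the real axis, the four edges carry a valid ANCHORED winding certificate
(`Literature.Analysis.Complex.HAPieces / VAPieces`, Henrici's step rule `Re (f/cₖ) > 0`), the real axis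
carries `m + 1` points `a < t₀ < … < t_m < b` with strictly sign-alternating values, and the certificate's
junction sum satisfies `Im (certAnchorSum …) < 2π (m + 1)`, then EVERY zero of `f` in the open rectangle
is REAL (and there are exactly `m` of them, all simple). The interval checker of Tier 2 discharges exactly
these hypotheses for `f = ξ₁⁽¹²⁸⁾` (series in `γ`-ratio enclosures); this file is the analytic top.
Nothing here bears on RH.
-/

-- D-0017: the doubled namespace is by design.
set_option linter.dupNamespace false

open Complex Set

namespace Summit.RiemannHypothesis.RiemannHypothesis.Theorems.JensenPolynomials.LogBand.CanaryAssembly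

open Literature.Analysis.Complex

/-- **Real zeros from sign alternation (real axis).** `m + 1` points `a < t₀ < … < t_m < b` with
strictly alternating real values of `f` (continuous on `[a,b]`, real on the axis) give `m` DISTINCT real
zeros `a < x₀ < … < x_{m-1} < b` (IVT). -/
theorem exists_strictMono_zeros_of_alternation {f : ℂ → ℂ} {a b : ℝ} {m : ℕ}
    (hcont : ∀ u ∈ Icc a b, ContinuousAt (fun s : ℝ ↦ (f s).re) u)
    (hreal : ∀ s : ℝ, (f s).im = 0)
    (t : Fin (m + 1) → ℝ) (ht : StrictMono t) (hta : a < t 0) (htb : t (Fin.last m) < b)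
    (halt : ∀ j : Fin m, (f (t j.castSucc)).re * (f (t j.succ)).re < 0) :
    ∃ x : Fin m → ℝ, StrictMono x ∧ ∀ j, x j ∈ Ioo a b ∧ f (x j) = 0 := by
  have ht_lo : ∀ j : Fin (m + 1), a < t j := fun j ↦
    lt_of_lt_of_le hta (ht.monotone (Fin.zero_le j))
  have ht_hi : ∀ j : Fin (m + 1), t j < b := fun j ↦
    lt_of_le_of_lt (ht.monotone (Fin.le_last j)) htb
  have hzero : ∀ j : Fin m, ∃ s, s ∈ Ioo (t j.castSucc) (t j.succ) ∧ f s = 0 := by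
    intro j
    have hlt : t j.castSucc < t j.succ := ht (Fin.castSucc_lt_succ (i := j))
    have hsub : Icc (t j.castSucc) (t j.succ) ⊆ Icc a b :=
      Icc_subset_Icc (ht_lo _).le (ht_hi _).le
    have hc : ContinuousOn (fun u : ℝ ↦ (f u).re) (Icc (t j.castSucc) (t j.succ)) :=
      fun u hu ↦ (hcont u (hsub hu)).continuousWithinAt
    have key : ∃ s ∈ Icc (t j.castSucc) (t j.succ), (f s).re = 0 := by
      rcases mul_neg_iff.mp (halt j) with ⟨hpos, hneg⟩ | ⟨hneg, hpos⟩
      · exact intermediate_value_Icc' hlt.le hc ⟨hneg.le, hpos.le⟩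
      · exact intermediate_value_Icc hlt.le hc ⟨hneg.le, hpos.le⟩
    obtain ⟨s, hs, hs0⟩ := key
    have hsa : s ≠ t j.castSucc := by
      intro h; rw [h] at hs0
      have := halt j; rw [hs0] at this; simp at this
    have hsb : s ≠ t j.succ := by
      intro h; rw [h] at hs0
      have := halt j; rw [hs0] at this; simp at this
    exact ⟨s, ⟨lt_of_le_of_ne hs.1 (Ne.symm hsa), lt_of_le_of_ne hs.2 hsb⟩,
      Complex.ext (by simpa using hs0) (by simpa using hreal s)⟩
  choose x hx_mem hx_zero using hzero
  refine ⟨x, ?_, fun j ↦ ⟨⟨lt_trans (ht_lo _) (hx_mem j).1, lt_trans (hx_mem j).2 (ht_hi _)⟩,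
    hx_zero j⟩⟩
  intro j k hjk
  have h1 : x j < t j.succ := (hx_mem j).2
  have h2 : t k.castSucc < x k := (hx_mem k).1
  have h3 : t j.succ ≤ t k.castSucc :=
    ht.monotone (Fin.castSucc_lt_iff_succ_le.mp (Fin.castSucc_lt_castSucc_iff.mpr hjk))
  linarith

variable {a b c d : ℝ}

/-- **Canary assembly (Architecture A).** Anchored winding certificate on `∂K` + `m + 1` strictly
alternating real-axis values + `Im (certAnchorSum) < 2π(m+1)` ⟹ every zero of `f` in the open rectangle
`K° = (a,b) × (c,d)` (`c < 0 < d`) is real. (`Im certAnchorSum = 2π · Σ_{ρ ∈ K°} m(ρ)` by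
`exists_count_of_anchored_certificate`; the `m` IVT zeros are distinct members of the zero set, each of
multiplicity `≥ 1`, so they exhaust it.) -/
theorem im_eq_zero_of_anchored_certificate_of_alternation {f : ℂ → ℂ} (hab : a < b)
    (hc : c < 0) (hd : 0 < d) (hf : AnalyticOnNhd ℂ f (Icc a b ×ℂ Icc c d))
    {xB : ℝ} {cB : ℂ} {LB : List (ℝ × ℂ)} (hB : HAPieces f c a ((xB, cB) :: LB))
    (hBe : apLast xB LB = b)
    {yR : ℝ} {cR : ℂ} {LR : List (ℝ × ℂ)} (hR : VAPieces f b c ((yR, cR) :: LR))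
    (hRe : apLast yR LR = d)
    {xT : ℝ} {cT : ℂ} {LT : List (ℝ × ℂ)} (hT : HAPieces f d a ((xT, cT) :: LT))
    (hTe : apLast xT LT = b)
    {yL : ℝ} {cL : ℂ} {LL : List (ℝ × ℂ)} (hL : VAPieces f a c ((yL, cL) :: LL))
    (hLe : apLast yL LL = d)
    (hreal : ∀ s : ℝ, (f s).im = 0)
    {m : ℕ} (t : Fin (m + 1) → ℝ) (ht : StrictMono t) (hta : a < t 0) (htb : t (Fin.last m) < b)
    (halt : ∀ j : Fin m, (f (t j.castSucc)).re * (f (t j.succ)).re < 0)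
    (him : (certAnchorSum cB LB cR LR cT LT cL LL).im < 2 * Real.pi * (m + 1)) :
    ∀ z ∈ Ioo a b ×ℂ Ioo c d, f z = 0 → z.im = 0 := by
  have hcd : c < d := hc.trans hd
  obtain ⟨s, mult, hs, hmult, -, hsum⟩ :=
    exists_count_of_anchored_certificate hab hcd hf hB hBe hR hRe hT hTe hL hLe
  -- the total multiplicity is at most m
  have hle : (∑ ρ ∈ s, mult ρ) ≤ m := by
    have h1 : (2 * Real.pi) * (((∑ ρ ∈ s, mult ρ : ℕ) : ℝ)) < (2 * Real.pi) * ((m : ℝ) + 1) := by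
      rw [← hsum]; linarith
    have h2 : ((∑ ρ ∈ s, mult ρ : ℕ) : ℝ) < (m : ℝ) + 1 :=
      lt_of_mul_lt_mul_left h1 (by positivity)
    have h3 : (∑ ρ ∈ s, mult ρ) < m + 1 := by exact_mod_cast h2
    omega
  -- m distinct real zeros inside K°
  have hcont : ∀ u ∈ Icc a b, ContinuousAt (fun s : ℝ ↦ (f s).re) u := by
    intro u hu
    have hmem : ((u : ℂ)) ∈ Icc a b ×ℂ Icc c d := ⟨by simpa using hu, by simp [hc.le, hd.le]⟩
    have h1 : ContinuousAt f (u : ℂ) := (hf _ hmem).continuousAt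
    exact Complex.continuous_re.continuousAt.comp (h1.comp Complex.continuous_ofReal.continuousAt)
  obtain ⟨x, hx, hxz⟩ := exists_strictMono_zeros_of_alternation hcont hreal t ht hta htb halt
  set S₀ : Finset ℂ := Finset.image (fun j : Fin m ↦ ((x j : ℝ) : ℂ)) Finset.univ with hS₀
  have hinj : Function.Injective (fun j : Fin m ↦ ((x j : ℝ) : ℂ)) := by
    intro j k hjk
    exact hx.injective (by simpa using hjk)
  have hS₀card : S₀.card = m := by
    rw [hS₀, Finset.card_image_of_injective _ hinj]; simp
  have hS₀sub : S₀ ⊆ s := by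
    intro z hz
    rw [hS₀, Finset.mem_image] at hz
    obtain ⟨j, -, rfl⟩ := hz
    rw [hs]
    exact ⟨(hxz j).2, ⟨by simpa using (hxz j).1, by simp [hc, hd]⟩⟩
  -- card s ≤ Σ mult ≤ m = card S₀ ≤ card s, so S₀ = s
  have hcard_le : s.card ≤ ∑ ρ ∈ s, mult ρ := by
    have := Finset.card_nsmul_le_sum s mult 1 (fun ρ hρ ↦ (hmult ρ hρ).1)
    simpa using this
  have hS₀eq : S₀ = s :=
    Finset.eq_of_subset_of_card_le hS₀sub (by rw [hS₀card]; exact hcard_le.trans hle)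
  -- conclusion
  intro z hz hz0
  have hzs : z ∈ s := (hs z).mpr ⟨hz0, hz⟩
  rw [← hS₀eq, hS₀, Finset.mem_image] at hzs
  obtain ⟨j, -, rfl⟩ := hzs
  simp

end Summit.RiemannHypothesis.RiemannHypothesis.Theorems.JensenPolynomials.LogBand.CanaryAssembly
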